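import Summits.HodgeConjecture.HodgeConjecture.Theorems.Ring2WeilCoverageNormClassEq
import Summits.HodgeConjecture.HodgeConjecture.Theorems.Ring2WeilCoverageNormTableC
import HarnessLib

/-!
# Weil-type family coverage — product windows, part O: ×2 of ring2-b02's `W6.1.21` / `W6.3.22` constructions, `n = 209`, more `S₃₃` / `S₂₁` data,
# and the folds of gen 50's kit jobs j202599 (`W6.2.13`) and j202732 (habitat2 K6: `W16.3.2`, `W18.3.2`)

research route conditional on HC_CM; not a corollary; Q11.4-sentence-2 already refuted in dim ≥ 3.

Ring 2, WEIL-TYPE FAMILY-COVERAGE CENSUS (`HOME/WEIL-FAMILY-COVERAGE.md` `## b04`, block b04.15 P.S., owner ring2-b04, gen 51); fifteenth part of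
`Ring2WeilCoverageProductWindow` (same conventions as parts L–N; mirror `HOME/pub-hodge-ring2-b04/census-g51/`).  LITERAL CLASSES for:
* §1 ×2 of ring2-b02 b02.22 («21:02:50Z», invited): the `(4,4,4)` data of `C₄ × PSL₃(4)`-on-21 (this seat builds `PSL₃(4)` on `PG(2,𝔽₄)`;
  three classes of elements of order 4 with cycle type `4⁴.2².1`, told apart here only up to the labelling `A/B/C`; genus 10 081, `Y` of genus 9
  on 84 sheets): `(3,3)`, class `[21]` = `W6.1.21` — CONCUR; and the `C₆ × M₁₁`-on-11 datum `(c1:632, c2:333, c3:55)` (genus 9 505; `Y` of genus 13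
  on 66 sheets): `(3,3)`, `det H = -8/33`, class `[22]` = `W6.3.22` — CONCUR (habitat2's K6 twist: `[11]·[2]`).
* §2 the pillowcase row `n = 209` (`W6.1.209`, kit j204913, 836 sheets), ring2-b04's random-realised `A₃₃ / S₃₃` data on `W6.1.33` (j204634; rigid
  `(24.8.1, 4⁸.1; 2¹⁶.1)`, `(28.4.1, 4⁸.1; 2¹⁶.1)` and a one-parameter family) and two more one-parameter `S₂₁` families on `W6.1.21` (j204635).
* §3 folds of gen 50's kit jobs: j202599 = ×2 of ring2-b02's `W6.2.13` datum `GL₂(3) × L₃(3)` `(0; 2:4422, 3:3333, 8a/8b:84A)` (g 39 313;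
  coset engine, 312 sheets): `(3,3)`, `T = {2,13}` — CONCUR, as S7 pre-registered; j202732 = habitat2's pattern-only K6 rows: `C₆ × A₄`
  `(0; c3:e⁵, c4:3A, c4:3B, c1:22)` g 97 = `(8,8)` on `W16.3.2` and `(0; c3:e⁵, c5:22, c5:3A, c5:3B)` g 109 = `(9,9)` on `W18.3.2`, both `T = {2,3}`
  exactly as habitat2's THEOREM K6 predicted (pre-registered in `census-g50/THEOREMS-S7.md` §7).

No `def`, no named fact, no `sorry`; nothing here is a statement about Hodge classes; `HC_CM` is used nowhere.
References: [cite: vanGeemen1994HodgeAV, (5.4.1), Lemma 5.2]; [cite: Serre1973, Ch. III §1].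
-/

set_option linter.dupNamespace false

open Literature.AlgebraicGeometry.Motives
open Literature.AlgebraicGeometry.VanGeemen1994
open Summit.HodgeConjecture.HodgeConjecture.Ring2.Hypotheses

namespace Summit.HodgeConjecture.HodgeConjecture.Ring2.WeilCoverage

/-! ### §1 ×2 of ring2-b02's `C₄ × PSL₃(4)` (`W6.1.21`) and `C₆ × M₁₁` (`W6.3.22`) data -/

-- Data of this gen whose literal `det H` coincides with a value already certified in parts L–N or above (same statement) are not repeated:
-- C4xL34 (c1:444422A,c1:444422A,c2:444422B): -4/21; C4xL34 (c1:444422C,c1:444422C,c2:444422A): -1/21; C4xS33 (c1:20.8.4.1,c1:4^8.1,c2:2^16.1,c0:2.1^31): -1/132; C4xS21 (c1:20.1,c1:4^4.2^2.1,c2:2^10.1,c0:2.1^19): -1/21; C4xS21 (c1:20.1,c1:4^5.1,c2:2^9.1^3,c0:2.1^19): -1/21.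

/-- FIBRE-PRODUCT datum `C4xL34` `(0; c1:444422A,c1:444422A,c2:444422A)` (cycle types in `L34`; Hurwitz dimension 0; realised by explicit permutations with product one, witness after 6 tries): `Y = D ×_{ℙ¹} X` (genus 9; `D` the `C4`-quotient datum = the CM elliptic curve, `X` the degree-21 cover, genus None), computed on its 84 sheets (engine `bigwin.py`, exact); the HIDDEN FACTOR `B` = the `λ`-part of the Prym `P(Y/D)` — an abelian SIXFOLD with `(3,3)` `ℚ(√-1)`-action, WEIL TYPE — has literal `det H|_B = -4/21`, `a = 4/21`, `T(a) = [3, 7]`: row `W6.1.21` (NON-split); `r₁ = dim_K H¹(D)_λ = 1`, `r_H = 7`. THEOREM S8 (Prym form of the product-window law, census b04.15 (A): `[a_B] = [n]^{r₁}`, no 2-transitivity needed) predicts `T(a_B) = [3, 7]` from `r₁ = 1`, `n = 21` — CONFIRMED.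
research route conditional on HC_CM; not a corollary; Q11.4-sentence-2 already refuted in dim ≥ 3. [cite: vanGeemen1994HodgeAV, (5.4.1)] -/
theorem x2_C4L34_n21_4243a4_mk_detH_ne_split :
    (QuotientGroup.mk (Units.mk0 (((-4 : ℚ) / 21)) (by norm_num)) : weilNormResidueGroup 1) ≠
      splitDiscriminantClass 3 1 := by
  have e : Units.mk0 (((-4 : ℚ) / 21)) (by norm_num) = -(Units.mk0 ((4 : ℚ) / 21) (by norm_num)) := Units.ext (by norm_num)
  rw [Ne, e, mk_neg_eq_splitDiscriminantClass_iff_of_odd (n := 3) (by decide)]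
  have h := mul_not_mem_normUnitsSubgroup (mem_normUnitsSubgroup_of_sq_add_mul_sq (d := 1) (a := ((4 : ℚ) / 441)) (by norm_num) ((2 : ℚ) / 21) (0 : ℚ) (by norm_num))
    Summit.HodgeConjecture.Ring2WeilNormDescent.twentyOne_not_mem_norm_one
  rw [mk0_mul_mk0] at h
  norm_num at h
  exact h

/-- The same datum, CELL IDENTIFICATION: `[det H|_B] = [-21]` in `ℚˣ/Nm(ℚ(√-1)ˣ)` — the census ROW KEY of `W6.1.21` (`a·21 = (4 : ℚ) = ((2 : ℚ))² + 1·((0 : ℚ))²`).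
research route conditional on HC_CM; not a corollary; Q11.4-sentence-2 already refuted in dim ≥ 3. [cite: vanGeemen1994HodgeAV, Lemma 5.2 (3)] -/
theorem x2_C4L34_n21_4243a4_mk_detH_eq_key :
    (QuotientGroup.mk (Units.mk0 (-(((4 : ℚ) / 21))) (neg_ne_zero.2 (by norm_num))) : weilNormResidueGroup 1) =
      QuotientGroup.mk (Units.mk0 (-(21 : ℚ)) (neg_ne_zero.2 (by norm_num))) :=
  mk_neg_eq_mk_neg_of_mul_mem (by norm_num) (by norm_num)
    (mem_normUnitsSubgroup_of_sq_add_mul_sq _ (2 : ℚ) (0 : ℚ) (by norm_num))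

/-- FIBRE-PRODUCT datum `C4xL34` `(0; c1:444422A,c1:444422B,c2:444422C)` (cycle types in `L34`; Hurwitz dimension 0; realised by explicit permutations with product one, witness after 16 tries): `Y = D ×_{ℙ¹} X` (genus 9; `D` the `C4`-quotient datum = the CM elliptic curve, `X` the degree-21 cover, genus None), computed on its 84 sheets (engine `bigwin.py`, exact); the HIDDEN FACTOR `B` = the `λ`-part of the Prym `P(Y/D)` — an abelian SIXFOLD with `(3,3)` `ℚ(√-1)`-action, WEIL TYPE — has literal `det H|_B = -5/42`, `a = 5/42`, `T(a) = [3, 7]`: row `W6.1.21` (NON-split); `r₁ = dim_K H¹(D)_λ = 1`, `r_H = 7`. THEOREM S8 (Prym form of the product-window law, census b04.15 (A): `[a_B] = [n]^{r₁}`, no 2-transitivity needed) predicts `T(a_B) = [3, 7]` from `r₁ = 1`, `n = 21` — CONFIRMED.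
research route conditional on HC_CM; not a corollary; Q11.4-sentence-2 already refuted in dim ≥ 3. [cite: vanGeemen1994HodgeAV, (5.4.1)] -/
theorem x2_C4L34_n21_1fc278_mk_detH_ne_split :
    (QuotientGroup.mk (Units.mk0 (((-5 : ℚ) / 42)) (by norm_num)) : weilNormResidueGroup 1) ≠
      splitDiscriminantClass 3 1 := by
  have e : Units.mk0 (((-5 : ℚ) / 42)) (by norm_num) = -(Units.mk0 ((5 : ℚ) / 42) (by norm_num)) := Units.ext (by norm_num)
  rw [Ne, e, mk_neg_eq_splitDiscriminantClass_iff_of_odd (n := 3) (by decide)]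
  have h := mul_not_mem_normUnitsSubgroup (mem_normUnitsSubgroup_of_sq_add_mul_sq (d := 1) (a := ((5 : ℚ) / 882)) (by norm_num) ((1 : ℚ) / 42) ((1 : ℚ) / 14) (by norm_num))
    Summit.HodgeConjecture.Ring2WeilNormDescent.twentyOne_not_mem_norm_one
  rw [mk0_mul_mk0] at h
  norm_num at h
  exact h

/-- The same datum, CELL IDENTIFICATION: `[det H|_B] = [-21]` in `ℚˣ/Nm(ℚ(√-1)ˣ)` — the census ROW KEY of `W6.1.21` (`a·21 = ((5 : ℚ) / 2) = (((1 : ℚ) / 2))² + 1·(((3 : ℚ) / 2))²`).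
research route conditional on HC_CM; not a corollary; Q11.4-sentence-2 already refuted in dim ≥ 3. [cite: vanGeemen1994HodgeAV, Lemma 5.2 (3)] -/
theorem x2_C4L34_n21_1fc278_mk_detH_eq_key :
    (QuotientGroup.mk (Units.mk0 (-(((5 : ℚ) / 42))) (neg_ne_zero.2 (by norm_num))) : weilNormResidueGroup 1) =
      QuotientGroup.mk (Units.mk0 (-(21 : ℚ)) (neg_ne_zero.2 (by norm_num))) :=
  mk_neg_eq_mk_neg_of_mul_mem (by norm_num) (by norm_num)
    (mem_normUnitsSubgroup_of_sq_add_mul_sq _ ((1 : ℚ) / 2) ((3 : ℚ) / 2) (by norm_num))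

/-- FIBRE-PRODUCT datum `C6xM11` `(0; c1:632,c2:333,c3:55)` (cycle types in `M11`; Hurwitz dimension 0; realised by explicit permutations with product one, witness after 3 tries): `Y = D ×_{ℙ¹} X` (genus 13; `D` the `C6`-quotient datum = the CM elliptic curve, `X` the degree-11 cover, genus None), computed on its 66 sheets (engine `bigwin.py`, exact); the HIDDEN FACTOR `B` = the `λ`-part of the Prym `P(Y/D)` — an abelian SIXFOLD with `(3,3)` `ℚ(√-3)`-action, WEIL TYPE — has literal `det H|_B = -8/33`, `a = 8/33`, `T(a) = [2, 11]`: row `W6.3.22` (NON-split); `r₁ = dim_K H¹(D)_λ = 1`, `r_H = 7`. THEOREM S8 does NOT apply to the carrier `C₆` (`2 ∈ S_in`): habitat2's THEOREM K6 twist `[2]^{m′}` — the class is `[n]^{r₁}·[2]^{m′}`; here `T(a_B) = [2, 11]` vs `T(n^{r₁}) = [3, 11]`.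
research route conditional on HC_CM; not a corollary; Q11.4-sentence-2 already refuted in dim ≥ 3. [cite: vanGeemen1994HodgeAV, (5.4.1)] -/
theorem x2_C6M11_n11_b4a064_mk_detH_ne_split :
    (QuotientGroup.mk (Units.mk0 (((-8 : ℚ) / 33)) (by norm_num)) : weilNormResidueGroup 3) ≠
      splitDiscriminantClass 3 3 := by
  have e : Units.mk0 (((-8 : ℚ) / 33)) (by norm_num) = -(Units.mk0 ((8 : ℚ) / 33) (by norm_num)) := Units.ext (by norm_num)
  rw [Ne, e, mk_neg_eq_splitDiscriminantClass_iff_of_odd (n := 3) (by decide)]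
  have h := mul_not_mem_normUnitsSubgroup (mem_normUnitsSubgroup_of_sq_add_mul_sq (d := 3) (a := ((4 : ℚ) / 363)) (by norm_num) (0 : ℚ) ((2 : ℚ) / 33) (by norm_num))
    Summit.HodgeConjecture.Ring2WeilNormDescent.twentyTwo_not_mem_norm_three
  rw [mk0_mul_mk0] at h
  norm_num at h
  exact h

/-- The same datum, CELL IDENTIFICATION: `[det H|_B] = [-22]` in `ℚˣ/Nm(ℚ(√-3)ˣ)` — the census ROW KEY of `W6.3.22` (`a·22 = ((16 : ℚ) / 3) = ((0 : ℚ))² + 3·(((4 : ℚ) / 3))²`).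
research route conditional on HC_CM; not a corollary; Q11.4-sentence-2 already refuted in dim ≥ 3. [cite: vanGeemen1994HodgeAV, Lemma 5.2 (3)] -/
theorem x2_C6M11_n11_b4a064_mk_detH_eq_key :
    (QuotientGroup.mk (Units.mk0 (-(((8 : ℚ) / 33))) (neg_ne_zero.2 (by norm_num))) : weilNormResidueGroup 3) =
      QuotientGroup.mk (Units.mk0 (-(22 : ℚ)) (neg_ne_zero.2 (by norm_num))) :=
  mk_neg_eq_mk_neg_of_mul_mem (by norm_num) (by norm_num)
    (mem_normUnitsSubgroup_of_sq_add_mul_sq _ (0 : ℚ) ((4 : ℚ) / 3) (by norm_num))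

/-! ### §2 `n = 209` (pillowcase, kit j204913) and the `S₃₃` / `S₂₁` data (kit j204634 / j204635) -/

/-- PILLOWCASE datum (B₂ alcove lattice, orbifold `ℙ¹(4,4,2) = E_i/C₄`): the double of the lattice 9-gon `P` with turning sequence `-2,+1,+3,-2,+2,+2,-1,+2,+3` (×45°) and side lengths `1,1,1,1,102,1,102,1,1` is a Belyi map `φ_P : ℙ¹ → ℙ¹` of degree `n = 209` (= number of alcoves of `P`) with passport `(5.4^50.2.1^2, 4^51.3.2, 3^2.2^101.1)` and monodromy group `S209` (certified: randomized Schreier–Sims lower bound = the full order); `Y_P : y⁴ = φ_P(φ_P − 1)` (genus 8) is the normalised fibre product `E ×_{ℙ¹} ℙ¹_{φ_P}` (836 sheets over `ℙ¹`; engine `bigwin.py`, exact) and the HIDDEN FACTOR `B` = the `λ`-part of the Prym `P(Y_P/E)` — an abelian SIXFOLD with `(3,3)` `ℚ(√-1)`-action, WEIL TYPE — has literal `det H|_B = -2/209`, `a = 2/209`, `T(a) = [11, 19]`: row `W6.1.209` (NON-split); `r₁ = dim_K H¹(D)_λ = 1`, `r_H = 7`. THEOREM S8 (Prym form of the product-window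 law, census b04.15 (A): `[a_B] = [n]^{r₁}`, no 2-transitivity needed) predicts `T(a_B) = [11, 19]` from `r₁ = 1`, `n = 209` — CONFIRMED.
research route conditional on HC_CM; not a corollary; Q11.4-sentence-2 already refuted in dim ≥ 3. [cite: vanGeemen1994HodgeAV, (5.4.1)] -/
theorem pillow4_C4S209_n209_f94a03_mk_detH_ne_split :
    (QuotientGroup.mk (Units.mk0 (((-2 : ℚ) / 209)) (by norm_num)) : weilNormResidueGroup 1) ≠
      splitDiscriminantClass 3 1 := by
  have e : Units.mk0 (((-2 : ℚ) / 209)) (by norm_num) = -(Units.mk0 ((2 : ℚ) / 209) (by norm_num)) := Units.ext (by norm_num)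
  rw [Ne, e, mk_neg_eq_splitDiscriminantClass_iff_of_odd (n := 3) (by decide)]
  have h := mul_not_mem_normUnitsSubgroup (mem_normUnitsSubgroup_of_sq_add_mul_sq (d := 1) (a := ((2 : ℚ) / 43681)) (by norm_num) ((1 : ℚ) / 209) ((1 : ℚ) / 209) (by norm_num))
    Summit.HodgeConjecture.HodgeConjecture.Ring2.WeilCoverage.SqrtNeg1.not_mem_209
  rw [mk0_mul_mk0] at h
  norm_num at h
  exact h

/-- The same datum, CELL IDENTIFICATION: `[det H|_B] = [-209]` in `ℚˣ/Nm(ℚ(√-1)ˣ)` — the census ROW KEY of `W6.1.209` (`a·209 = (2 : ℚ) = ((1 : ℚ))² + 1·((1 : ℚ))²`).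
research route conditional on HC_CM; not a corollary; Q11.4-sentence-2 already refuted in dim ≥ 3. [cite: vanGeemen1994HodgeAV, Lemma 5.2 (3)] -/
theorem pillow4_C4S209_n209_f94a03_mk_detH_eq_key :
    (QuotientGroup.mk (Units.mk0 (-(((2 : ℚ) / 209))) (neg_ne_zero.2 (by norm_num))) : weilNormResidueGroup 1) =
      QuotientGroup.mk (Units.mk0 (-(209 : ℚ)) (neg_ne_zero.2 (by norm_num))) :=
  mk_neg_eq_mk_neg_of_mul_mem (by norm_num) (by norm_num)
    (mem_normUnitsSubgroup_of_sq_add_mul_sq _ (1 : ℚ) (1 : ℚ) (by norm_num))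

/-- FIBRE-PRODUCT datum `C4xA33` `(0; c1:28.4.1,c1:4^8.1,c2:2^16.1)` (cycle types in `A33`; Hurwitz dimension 0; realised by explicit permutations with product one, generation: randomized Schreier-Sims lower bound = 33!/2): `Y = D ×_{ℙ¹} X` (genus 13; `D` the `C4`-quotient datum = the CM elliptic curve, `X` the degree-33 cover, genus 3), computed on its 132 sheets (engine `bigwin.py`, exact); the HIDDEN FACTOR `B` = the `λ`-part of the Prym `P(Y/D)` — an abelian SIXFOLD with `(3,3)` `ℚ(√-1)`-action, WEIL TYPE — has literal `det H|_B = -1/2112`, `a = 1/2112`, `T(a) = [3, 11]`: row `W6.1.33` (NON-split); `r₁ = dim_K H¹(D)_λ = 1`, `r_H = 7`. THEOREM S8 (Prym form of the product-window law, census b04.15 (A): `[a_B] = [n]^{r₁}`, no 2-transitivity needed) predicts `T(a_B) = [3, 11]` from `r₁ = 1`, `n = 33` — CONFIRMED.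
research route conditional on HC_CM; not a corollary; Q11.4-sentence-2 already refuted in dim ≥ 3. [cite: vanGeemen1994HodgeAV, (5.4.1)] -/
theorem fibre_C4A33_n33_85a072_mk_detH_ne_split :
    (QuotientGroup.mk (Units.mk0 (((-1 : ℚ) / 2112)) (by norm_num)) : weilNormResidueGroup 1) ≠
      splitDiscriminantClass 3 1 := by
  have e : Units.mk0 (((-1 : ℚ) / 2112)) (by norm_num) = -(Units.mk0 ((1 : ℚ) / 2112) (by norm_num)) := Units.ext (by norm_num)
  rw [Ne, e, mk_neg_eq_splitDiscriminantClass_iff_of_odd (n := 3) (by decide)]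
  have h := mul_not_mem_normUnitsSubgroup (mem_normUnitsSubgroup_of_sq_add_mul_sq (d := 1) (a := ((1 : ℚ) / 69696)) (by norm_num) ((1 : ℚ) / 264) (0 : ℚ) (by norm_num))
    Summit.HodgeConjecture.HodgeConjecture.Ring2.WeilCoverage.SqrtNeg1.not_mem_33
  rw [mk0_mul_mk0] at h
  norm_num at h
  exact h

/-- The same datum, CELL IDENTIFICATION: `[det H|_B] = [-33]` in `ℚˣ/Nm(ℚ(√-1)ˣ)` — the census ROW KEY of `W6.1.33` (`a·33 = ((1 : ℚ) / 64) = (((1 : ℚ) / 8))² + 1·((0 : ℚ))²`).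
research route conditional on HC_CM; not a corollary; Q11.4-sentence-2 already refuted in dim ≥ 3. [cite: vanGeemen1994HodgeAV, Lemma 5.2 (3)] -/
theorem fibre_C4A33_n33_85a072_mk_detH_eq_key :
    (QuotientGroup.mk (Units.mk0 (-(((1 : ℚ) / 2112))) (neg_ne_zero.2 (by norm_num))) : weilNormResidueGroup 1) =
      QuotientGroup.mk (Units.mk0 (-(33 : ℚ)) (neg_ne_zero.2 (by norm_num))) :=
  mk_neg_eq_mk_neg_of_mul_mem (by norm_num) (by norm_num)
    (mem_normUnitsSubgroup_of_sq_add_mul_sq _ ((1 : ℚ) / 8) (0 : ℚ) (by norm_num))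

/-- FIBRE-PRODUCT datum `C4xA33` `(0; c1:24.8.1,c1:4^8.1,c2:2^16.1)` (cycle types in `A33`; Hurwitz dimension 0; realised by explicit permutations with product one, generation: randomized Schreier-Sims lower bound = 33!/2): `Y = D ×_{ℙ¹} X` (genus 13; `D` the `C4`-quotient datum = the CM elliptic curve, `X` the degree-33 cover, genus 3), computed on its 132 sheets (engine `bigwin.py`, exact); the HIDDEN FACTOR `B` = the `λ`-part of the Prym `P(Y/D)` — an abelian SIXFOLD with `(3,3)` `ℚ(√-1)`-action, WEIL TYPE — has literal `det H|_B = -1/132`, `a = 1/132`, `T(a) = [3, 11]`: row `W6.1.33` (NON-split); `r₁ = dim_K H¹(D)_λ = 1`, `r_H = 7`. THEOREM S8 (Prym form of the product-window law, census b04.15 (A): `[a_B] = [n]^{r₁}`, no 2-transitivity needed) predicts `T(a_B) = [3, 11]` from `r₁ = 1`, `n = 33` — CONFIRMED.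
research route conditional on HC_CM; not a corollary; Q11.4-sentence-2 already refuted in dim ≥ 3. [cite: vanGeemen1994HodgeAV, (5.4.1)] -/
theorem fibre_C4A33_n33_354644_mk_detH_ne_split :
    (QuotientGroup.mk (Units.mk0 (((-1 : ℚ) / 132)) (by norm_num)) : weilNormResidueGroup 1) ≠
      splitDiscriminantClass 3 1 := by
  have e : Units.mk0 (((-1 : ℚ) / 132)) (by norm_num) = -(Units.mk0 ((1 : ℚ) / 132) (by norm_num)) := Units.ext (by norm_num)
  rw [Ne, e, mk_neg_eq_splitDiscriminantClass_iff_of_odd (n := 3) (by decide)]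
  have h := mul_not_mem_normUnitsSubgroup (mem_normUnitsSubgroup_of_sq_add_mul_sq (d := 1) (a := ((1 : ℚ) / 4356)) (by norm_num) ((1 : ℚ) / 66) (0 : ℚ) (by norm_num))
    Summit.HodgeConjecture.HodgeConjecture.Ring2.WeilCoverage.SqrtNeg1.not_mem_33
  rw [mk0_mul_mk0] at h
  norm_num at h
  exact h

/-- The same datum, CELL IDENTIFICATION: `[det H|_B] = [-33]` in `ℚˣ/Nm(ℚ(√-1)ˣ)` — the census ROW KEY of `W6.1.33` (`a·33 = ((1 : ℚ) / 4) = (((1 : ℚ) / 2))² + 1·((0 : ℚ))²`).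
research route conditional on HC_CM; not a corollary; Q11.4-sentence-2 already refuted in dim ≥ 3. [cite: vanGeemen1994HodgeAV, Lemma 5.2 (3)] -/
theorem fibre_C4A33_n33_354644_mk_detH_eq_key :
    (QuotientGroup.mk (Units.mk0 (-(((1 : ℚ) / 132))) (neg_ne_zero.2 (by norm_num))) : weilNormResidueGroup 1) =
      QuotientGroup.mk (Units.mk0 (-(33 : ℚ)) (neg_ne_zero.2 (by norm_num))) :=
  mk_neg_eq_mk_neg_of_mul_mem (by norm_num) (by norm_num)
    (mem_normUnitsSubgroup_of_sq_add_mul_sq _ ((1 : ℚ) / 2) (0 : ℚ) (by norm_num))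

/-- FIBRE-PRODUCT datum `C4xS21` `(0; c1:20.1,c1:4^4.2^2.1,c2:2^9.1^3)` (cycle types in `S21`; Hurwitz dimension 0; realised by explicit permutations with product one, generation: randomized Schreier-Sims lower bound = 21!): `Y = D ×_{ℙ¹} X` (genus 9; `D` the `C4`-quotient datum = the CM elliptic curve, `X` the degree-21 cover, genus 1), computed on its 84 sheets (engine `bigwin.py`, exact); the HIDDEN FACTOR `B` = the `λ`-part of the Prym `P(Y/D)` — an abelian SIXFOLD with `(3,3)` `ℚ(√-1)`-action, WEIL TYPE — has literal `det H|_B = -1/42`, `a = 1/42`, `T(a) = [3, 7]`: row `W6.1.21` (NON-split); `r₁ = dim_K H¹(D)_λ = 1`, `r_H = 7`. THEOREM S8 (Prym form of the product-window law, census b04.15 (A): `[a_B] = [n]^{r₁}`, no 2-transitivity needed) predicts `T(a_B) = [3, 7]` from `r₁ = 1`, `n = 21` — CONFIRMED.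
research route conditional on HC_CM; not a corollary; Q11.4-sentence-2 already refuted in dim ≥ 3. [cite: vanGeemen1994HodgeAV, (5.4.1)] -/
theorem fibre_C4S21_n21_d88e32_mk_detH_ne_split :
    (QuotientGroup.mk (Units.mk0 (((-1 : ℚ) / 42)) (by norm_num)) : weilNormResidueGroup 1) ≠
      splitDiscriminantClass 3 1 := by
  have e : Units.mk0 (((-1 : ℚ) / 42)) (by norm_num) = -(Units.mk0 ((1 : ℚ) / 42) (by norm_num)) := Units.ext (by norm_num)
  rw [Ne, e, mk_neg_eq_splitDiscriminantClass_iff_of_odd (n := 3) (by decide)]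
  have h := mul_not_mem_normUnitsSubgroup (mem_normUnitsSubgroup_of_sq_add_mul_sq (d := 1) (a := ((1 : ℚ) / 882)) (by norm_num) ((1 : ℚ) / 42) ((1 : ℚ) / 42) (by norm_num))
    Summit.HodgeConjecture.Ring2WeilNormDescent.twentyOne_not_mem_norm_one
  rw [mk0_mul_mk0] at h
  norm_num at h
  exact h

/-- The same datum, CELL IDENTIFICATION: `[det H|_B] = [-21]` in `ℚˣ/Nm(ℚ(√-1)ˣ)` — the census ROW KEY of `W6.1.21` (`a·21 = ((1 : ℚ) / 2) = (((1 : ℚ) / 2))² + 1·(((1 : ℚ) / 2))²`).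
research route conditional on HC_CM; not a corollary; Q11.4-sentence-2 already refuted in dim ≥ 3. [cite: vanGeemen1994HodgeAV, Lemma 5.2 (3)] -/
theorem fibre_C4S21_n21_d88e32_mk_detH_eq_key :
    (QuotientGroup.mk (Units.mk0 (-(((1 : ℚ) / 42))) (neg_ne_zero.2 (by norm_num))) : weilNormResidueGroup 1) =
      QuotientGroup.mk (Units.mk0 (-(21 : ℚ)) (neg_ne_zero.2 (by norm_num))) :=
  mk_neg_eq_mk_neg_of_mul_mem (by norm_num) (by norm_num)
    (mem_normUnitsSubgroup_of_sq_add_mul_sq _ ((1 : ℚ) / 2) ((1 : ℚ) / 2) (by norm_num))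

/-! ### §3 Folds of gen 50's kit jobs j202599 (`GL₂(3) × L₃(3)`, `W6.2.13`) and j202732 (`C₆ × A₄`, habitat2 K6 rows `W16.3.2`, `W18.3.2`) -/

/-- FIBRE-PRODUCT datum `GL23xL33` `(0; 2:4422,3:3333,8a:84A)` (cycle types in `L33`; Hurwitz dimension 0; realised by explicit permutations with product one, ): `Y = D ×_{ℙ¹} X` (genus 31; `D` the `GL23`-quotient datum = the CM elliptic curve, `X` the degree-13 cover, genus None), computed on its 312 sheets (engine `bigwin.py`, exact); the HIDDEN FACTOR `B` = the `λ`-part of the Prym `P(Y/D)` — an abelian SIXFOLD with `(3,3)` `ℚ(√-2)`-action, WEIL TYPE — has literal `det H|_B = -11/7488`, `a = 11/7488`, `T(a) = [2, 13]`: row `W6.2.13` (NON-split); `r₁ = dim_K H¹(D)_λ = 1`, `r_H = 7`. THEOREM S8 (Prym form of the product-window law, census b04.15 (A): `[a_B] = [n]^{r₁}`, no 2-transitivity needed) predicts `T(a_B) = [2, 13]` from `r₁ = 1`, `n = 13` — CONFIRMED.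
research route conditional on HC_CM; not a corollary; Q11.4-sentence-2 already refuted in dim ≥ 3. [cite: vanGeemen1994HodgeAV, (5.4.1)] -/
theorem pw_GL23L33_n13_10a84f_mk_detH_ne_split :
    (QuotientGroup.mk (Units.mk0 (((-11 : ℚ) / 7488)) (by norm_num)) : weilNormResidueGroup 2) ≠
      splitDiscriminantClass 3 2 := by
  have e : Units.mk0 (((-11 : ℚ) / 7488)) (by norm_num) = -(Units.mk0 ((11 : ℚ) / 7488) (by norm_num)) := Units.ext (by norm_num)
  rw [Ne, e, mk_neg_eq_splitDiscriminantClass_iff_of_odd (n := 3) (by decide)]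
  have h := mul_not_mem_normUnitsSubgroup (mem_normUnitsSubgroup_of_sq_add_mul_sq (d := 2) (a := ((11 : ℚ) / 97344)) (by norm_num) ((1 : ℚ) / 104) ((1 : ℚ) / 312) (by norm_num))
    Summit.HodgeConjecture.Ring2WeilNormDescent.thirteen_not_mem_norm_two
  rw [mk0_mul_mk0] at h
  norm_num at h
  exact h

/-- The same datum, CELL IDENTIFICATION: `[det H|_B] = [-13]` in `ℚˣ/Nm(ℚ(√-2)ˣ)` — the census ROW KEY of `W6.2.13` (`a·13 = ((11 : ℚ) / 576) = (((1 : ℚ) / 8))² + 2·(((1 : ℚ) / 24))²`).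
research route conditional on HC_CM; not a corollary; Q11.4-sentence-2 already refuted in dim ≥ 3. [cite: vanGeemen1994HodgeAV, Lemma 5.2 (3)] -/
theorem pw_GL23L33_n13_10a84f_mk_detH_eq_key :
    (QuotientGroup.mk (Units.mk0 (-(((11 : ℚ) / 7488))) (neg_ne_zero.2 (by norm_num))) : weilNormResidueGroup 2) =
      QuotientGroup.mk (Units.mk0 (-(13 : ℚ)) (neg_ne_zero.2 (by norm_num))) :=
  mk_neg_eq_mk_neg_of_mul_mem (by norm_num) (by norm_num)
    (mem_normUnitsSubgroup_of_sq_add_mul_sq _ ((1 : ℚ) / 8) ((1 : ℚ) / 24) (by norm_num))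

/-- FIBRE-PRODUCT datum `GL23xL33` `(0; 2:4422,3:3333,8b:84A)` (cycle types in `L33`; Hurwitz dimension 0; realised by explicit permutations with product one, ): `Y = D ×_{ℙ¹} X` (genus 31; `D` the `GL23`-quotient datum = the CM elliptic curve, `X` the degree-13 cover, genus None), computed on its 312 sheets (engine `bigwin.py`, exact); the HIDDEN FACTOR `B` = the `λ`-part of the Prym `P(Y/D)` — an abelian SIXFOLD with `(3,3)` `ℚ(√-2)`-action, WEIL TYPE — has literal `det H|_B = -1/16848`, `a = 1/16848`, `T(a) = [2, 13]`: row `W6.2.13` (NON-split); `r₁ = dim_K H¹(D)_λ = 1`, `r_H = 7`. THEOREM S8 (Prym form of the product-window law, census b04.15 (A): `[a_B] = [n]^{r₁}`, no 2-transitivity needed) predicts `T(a_B) = [2, 13]` from `r₁ = 1`, `n = 13` — CONFIRMED.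
research route conditional on HC_CM; not a corollary; Q11.4-sentence-2 already refuted in dim ≥ 3. [cite: vanGeemen1994HodgeAV, (5.4.1)] -/
theorem pw_GL23L33_n13_529b91_mk_detH_ne_split :
    (QuotientGroup.mk (Units.mk0 (((-1 : ℚ) / 16848)) (by norm_num)) : weilNormResidueGroup 2) ≠
      splitDiscriminantClass 3 2 := by
  have e : Units.mk0 (((-1 : ℚ) / 16848)) (by norm_num) = -(Units.mk0 ((1 : ℚ) / 16848) (by norm_num)) := Units.ext (by norm_num)
  rw [Ne, e, mk_neg_eq_splitDiscriminantClass_iff_of_odd (n := 3) (by decide)]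
  have h := mul_not_mem_normUnitsSubgroup (mem_normUnitsSubgroup_of_sq_add_mul_sq (d := 2) (a := ((1 : ℚ) / 219024)) (by norm_num) ((1 : ℚ) / 468) (0 : ℚ) (by norm_num))
    Summit.HodgeConjecture.Ring2WeilNormDescent.thirteen_not_mem_norm_two
  rw [mk0_mul_mk0] at h
  norm_num at h
  exact h

/-- The same datum, CELL IDENTIFICATION: `[det H|_B] = [-13]` in `ℚˣ/Nm(ℚ(√-2)ˣ)` — the census ROW KEY of `W6.2.13` (`a·13 = ((1 : ℚ) / 1296) = (((1 : ℚ) / 36))² + 2·((0 : ℚ))²`).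
research route conditional on HC_CM; not a corollary; Q11.4-sentence-2 already refuted in dim ≥ 3. [cite: vanGeemen1994HodgeAV, Lemma 5.2 (3)] -/
theorem pw_GL23L33_n13_529b91_mk_detH_eq_key :
    (QuotientGroup.mk (Units.mk0 (-(((1 : ℚ) / 16848))) (neg_ne_zero.2 (by norm_num))) : weilNormResidueGroup 2) =
      QuotientGroup.mk (Units.mk0 (-(13 : ℚ)) (neg_ne_zero.2 (by norm_num))) :=
  mk_neg_eq_mk_neg_of_mul_mem (by norm_num) (by norm_num)
    (mem_normUnitsSubgroup_of_sq_add_mul_sq _ ((1 : ℚ) / 36) (0 : ℚ) (by norm_num))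

/-- `C6xA4`-cover `(0; c3:e,c3:e,c3:e,c3:e,c3:e,c4:3A,c4:3B,c1:22)` (genus 97, Hurwitz dimension 5; engine `prodwin.py` on the Galois cover, exact): the HIDDEN FACTOR `B = V^{H₁×Stab(0)}` of the `(λ⊗ρ)`-piece — an abelian SIXTEENFOLD with `(8,8)` `ℚ(√-3)`-action, WEIL TYPE — has literal `det H|_B = 157464`, `a = 157464`, `T(a) = [2, 3]`: row `W16.3.2` (NON-split); `r₁ = dim_K H¹(D)_λ = 6`, `r_H = None`. THEOREM S8 does NOT apply to the carrier `C₆` (`2 ∈ S_in`): habitat2's THEOREM K6 twist `[2]^{m′}` — the class is `[n]^{r₁}·[2]^{m′}`; here `T(a_B) = [2, 3]` vs `T(n^{r₁}) = []`.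
research route conditional on HC_CM; not a corollary; Q11.4-sentence-2 already refuted in dim ≥ 3. [cite: vanGeemen1994HodgeAV, (5.4.1)] -/
theorem pw_C6A4_n4_34ca04_mk_detH_ne_split :
    (QuotientGroup.mk (Units.mk0 ((157464 : ℚ)) (by norm_num)) : weilNormResidueGroup 3) ≠
      splitDiscriminantClass 8 3 := by
  have e : Units.mk0 ((157464 : ℚ)) (by norm_num) = Units.mk0 (157464 : ℚ) (by norm_num) := Units.ext (by norm_num)
  rw [Ne, e, mk_eq_splitDiscriminantClass_iff_of_even (n := 8) (by decide)]
  have h := mul_not_mem_normUnitsSubgroup (mem_normUnitsSubgroup_of_sq_add_mul_sq (d := 3) (a := (78732 : ℚ)) (by norm_num) (0 : ℚ) (162 : ℚ) (by norm_num))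
    Summit.HodgeConjecture.Ring2WeilNormDescent.two_not_mem_norm_three
  rw [mk0_mul_mk0] at h
  norm_num at h
  exact h

/-- The same datum, CELL IDENTIFICATION: `[det H|_B] = [2]` in `ℚˣ/Nm(ℚ(√-3)ˣ)` — the census ROW KEY of `W16.3.2` (`a·2 = (314928 : ℚ) = ((0 : ℚ))² + 3·((324 : ℚ))²`).
research route conditional on HC_CM; not a corollary; Q11.4-sentence-2 already refuted in dim ≥ 3. [cite: vanGeemen1994HodgeAV, Lemma 5.2 (3)] -/
theorem pw_C6A4_n4_34ca04_mk_detH_eq_key :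
    (QuotientGroup.mk (Units.mk0 ((157464 : ℚ)) (by norm_num)) : weilNormResidueGroup 3) =
      QuotientGroup.mk (Units.mk0 (2 : ℚ) (by norm_num)) :=
  mk_eq_mk_of_mul_mem (by norm_num) (by norm_num)
    (mem_normUnitsSubgroup_of_sq_add_mul_sq _ (0 : ℚ) (324 : ℚ) (by norm_num))

/-- `C6xA4`-cover `(0; c3:e,c3:e,c3:e,c3:e,c3:e,c5:22,c5:3A,c5:3B)` (genus 109, Hurwitz dimension 5; engine `prodwin.py` on the Galois cover, exact): the HIDDEN FACTOR `B = V^{H₁×Stab(0)}` of the `(λ⊗ρ)`-piece — an abelian EIGHTEENFOLD with `(9,9)` `ℚ(√-3)`-action, WEIL TYPE — has literal `det H|_B = -1889568`, `a = 1889568`, `T(a) = [2, 3]`: row `W18.3.2` (NON-split); `r₁ = dim_K H¹(D)_λ = 6`, `r_H = None`. THEOREM S8 does NOT apply to the carrier `C₆` (`2 ∈ S_in`): habitat2's THEOREM K6 twist `[2]^{m′}` — the class is `[n]^{r₁}·[2]^{m′}`; here `T(a_B) = [2, 3]` vs `T(n^{r₁}) = []`.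
research route conditional on HC_CM; not a corollary; Q11.4-sentence-2 already refuted in dim ≥ 3. [cite: vanGeemen1994HodgeAV, (5.4.1)] -/
theorem pw_C6A4_n4_a3a843_mk_detH_ne_split :
    (QuotientGroup.mk (Units.mk0 ((-1889568 : ℚ)) (by norm_num)) : weilNormResidueGroup 3) ≠
      splitDiscriminantClass 9 3 := by
  have e : Units.mk0 ((-1889568 : ℚ)) (by norm_num) = -(Units.mk0 (1889568 : ℚ) (by norm_num)) := Units.ext (by norm_num)
  rw [Ne, e, mk_neg_eq_splitDiscriminantClass_iff_of_odd (n := 9) (by decide)]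
  have h := mul_not_mem_normUnitsSubgroup (mem_normUnitsSubgroup_of_sq_add_mul_sq (d := 3) (a := (944784 : ℚ)) (by norm_num) (972 : ℚ) (0 : ℚ) (by norm_num))
    Summit.HodgeConjecture.Ring2WeilNormDescent.two_not_mem_norm_three
  rw [mk0_mul_mk0] at h
  norm_num at h
  exact h

/-- The same datum, CELL IDENTIFICATION: `[det H|_B] = [-2]` in `ℚˣ/Nm(ℚ(√-3)ˣ)` — the census ROW KEY of `W18.3.2` (`a·2 = (3779136 : ℚ) = ((1944 : ℚ))² + 3·((0 : ℚ))²`).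
research route conditional on HC_CM; not a corollary; Q11.4-sentence-2 already refuted in dim ≥ 3. [cite: vanGeemen1994HodgeAV, Lemma 5.2 (3)] -/
theorem pw_C6A4_n4_a3a843_mk_detH_eq_key :
    (QuotientGroup.mk (Units.mk0 (-((1889568 : ℚ))) (neg_ne_zero.2 (by norm_num))) : weilNormResidueGroup 3) =
      QuotientGroup.mk (Units.mk0 (-(2 : ℚ)) (neg_ne_zero.2 (by norm_num))) :=
  mk_neg_eq_mk_neg_of_mul_mem (by norm_num) (by norm_num)
    (mem_normUnitsSubgroup_of_sq_add_mul_sq _ (1944 : ℚ) (0 : ℚ) (by norm_num))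

end Summit.HodgeConjecture.HodgeConjecture.Ring2.WeilCoverage
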